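/-
Copyright: lit-balaban cell, Phase-2 proof seat p11 (gen 7; v1.1 docstring locator correction gen 8).  Statement-level skeleton of a
published paper; no proof claims beyond what the kernel checks below.
-/
import Literature.MathematicalPhysics.QuantumFieldTheory.BalabanImbrieJaffe1984to88.BIJ85GaugeFnBound513
import Literature.MathematicalPhysics.QuantumFieldTheory.Balaban1983to89.B5Eq118OneStroke
import Literature.MathematicalPhysics.QuantumFieldTheory.Balaban1983to89.B15DeterminingSets

/-!
# `BalabanImbrieJaffe1984to88.BIJ85TreeGaugeLineSums` — T. Bałaban, J. Imbrie, A. Jaffe, *Renormalization of the Higgs model: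
minimizers, propagators and the stability of mean field theory*, Commun. Math. Phys. **97** (1985) 299–329 [BalabanImbrieJaffe1985]:
Sect. 4.1 (4.1.2) / Sect. 5.1 (5.1.2)–(5.1.3) / Sect. 7.3 p. 326 — **LINE SUMS OF A FIELD IN THE ITERATED AXIAL GAUGE ARE ITS BLOCK
AVERAGES, UP TO A FLUX**: the multilevel tree-gauge/Stokes lemma behind the p. 326 sentence *"we use (5.3.1) to replace this by a
minimizer in axial gauge … This is a local procedure since f^{(k)} can locally be represented as a curl"* (file 1 of the gen-7 member of
SKELETON row **C1.Eq7.3.1-7.3.2**, second printed form of (7.3.2); files 2–3 = `BIJ85AxialLineSum`, `BIJ85LineSumCentre`).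

statement-level skeleton of published theorems with citation tags; proofs where landed; nothing here is a claim about the Yang–Mills mass gap

PDF held: `paper:balaban1985-cmp97-bij-higgs-minimizers` (journal page = PDF page + 298).  Pages re-read this session (OCR text,
`lit read … --pages 4-19,27-29`): p. 304–305 [PDF 6–7] ((2.13)–(2.24)), p. 309 [PDF 11] ((4.1.1)–(4.1.2)), p. 313–314 [PDF 15–16]
((5.1.1)–(5.1.4)), p. 326 [PDF 28].

CITATION HEADER (lean-in-tree rule).  Phase-2 file of the lit-balaban TYPED SKELETON (HOME `run/shared/lean/pub/lit-balaban/`), seat p11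
gen 7 (unit `lit-balaban-p11-g7`; TAKING line HOME/STATUS.md 2026-08-21T22:35:54Z; owner r15, referee ref-5).  Carriers and operators OF
RECORD, nothing re-declared: r18's `…Balaban1983to89.LatticeFieldCalculus` (tori `Setup.Site P j`, `VecField`, straight runs `runSite`/
`runBond`/`segSum` (2.13) = [6I] (1.8), block averages `bondAvg`/`bondAvgIter` = `Q`/`Q_k` (2.13)/(2.23) = [6I] (1.11)/(1.18), staircase
contours `stairSum` = `A(Γ_{y,x})` and the axial gauge `IsAxial` ([6I] (1.10)) for the CENTRED blocks of `Setup` (`emb` = block centre,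
DIVERGENCE F3 of `pub-balaban`), the plaquette variable `curl`), p09's `BIJ85AxialPropagator411.deltaAx` = `δ_{k,Ax}` (4.1.2), r12's
iterated centre embedding `B15DeterminingSets.embIter` (`T^{(k)} ⊂ T^{(0)}`), pv's `B5Eq118OneStroke.segSum_add/segSum_mul/runSite_add`,
p08's `BIJ85GaugeFnBound513.norm_stairSum_le` (a staircase inside a block is short).  New definitions (with bodies, all elementary
bookkeeping terms): `pcirc` (oriented plaquette circulation, any pair of directions), `sweepFlux` (the flux through the ribbon swept by a
bond moved `n` steps), `translate` (a bond field read `n` steps further), `lineFn` (the straight-run sum as a function of its base point),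
`cline` (the CENTRE LINE SUM `Σ_{b′ ⊂ centre line of b} A(b′)` of a fine field along a coarse bond), `tgConst` (the constant of the main
estimate).  Otherwise theorems only (no `def … : Prop`, no named fact; D-0026).

THE PRINTED TEXT this file serves, verbatim.  p. 309 [PDF 11]: *"δ_{k,Ax}(A) ≡ Π_{j=0}^{k−1} δ_{Ax}(Q_jA). (4.1.2) The j^th factor in the
product acts on the L^jη = L^{j−k} lattice. It sets bond field averages Q_jA to zero on contours Γ_{yx} defined in the L^jη lattice in the
same way that the axial gauge was fixed in Sect. 3 on contours in the unit lattice."*; p. 313 [PDF 15] l. 32–34: *"In order to specify λ,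
we choose a sequence of points x₀, …, x_k, where x = x₀, y = x_k, and where x ∈ B^j(x_j), x_j ∈ T^{(j)}_η, (5.1.2)"* … p. 314 [PDF 16] l. 4
(after the display (5.1.3)): *"The contour Γ_{x_k,…,x} runs from x to x₁ in B(x₁), from x₁ to x₂ in B²(x₂), etc."* (v1.1: v1 gave both
sentences the single locator p. 313; the second is printed on p. 314 — referee ref-1's gen-48 sweep request; texts unchanged, re-read on the
OCR layer p0015/p0016); p. 304 [PDF 6]: *"(QA)_{b′} = L^{−(d+1)} Σ_{x∈B(b′₋)} Σ_{b∈Γ_{xx′}} A_b, (2.13) where Γ_{xx′}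
is the special contour from x to x′ and xx′ is the parallel transport of the bond b′ to start at x."*; p. 326 [PDF 28]: *"The second form
of the inequality substitutes v_b for u_k(b) in the covariant derivative of φ. These inequalities can be proved by an extension of the
proofs of [7]. … we use (5.3.1) to replace this by a minimizer in axial gauge … This is a local procedure since f^{(k)} can locally be
represented as a curl."*

WHAT IS PROVED HERE (0 `sorry`, standard axioms), for REAL bond fields on the tori, in the standing range:
* §1 one ribbon (Stokes for a straight run moved sideways): **`grad_lineFn`** — `A([x+e_ν, x+e_ν+ne_μ]) − A([x, x+ne_μ]) =
  Σ_{t<n} A(∂p_t) + [A(⟨x+ne_μ, ν⟩) − A(⟨x, ν⟩)]` (`p_t` the plaquettes swept by the bond `⟨x,ν⟩`), i.e. `∂(lineFn) = sweepFlux +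
  (translate − id)` as bond fields; `abs_pcirc_le`/`abs_sweepFlux_le` (`|sweepFlux| ≤ n·max_p|A(∂p)|`).
* §2 staircases: **`segSum_sub_segSum_eq`** — for ANY two base points, `A([x, x+ne_μ]) − A([y, y+ne_μ]) = sweepFlux(Γ_{y,x}) +
  [A(Γ_{y+ne_μ, x+ne_μ}) − A(Γ_{y,x})]` (the staircase telescoping `B5Eq120IterProof.stairSum_grad` applied to `lineFn`, translation
  covariance of `stairSum`); hence in the AXIAL GAUGE of a block (`IsAxial`: `A(Γ_{y,x}) = 0` for the centre `y` and `x ∈ B(y)`):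
  **`abs_segSum_sub_segSum_centre_le`** — `|A([x, x+Le_μ]) − A([emb y, emb y + Le_μ])| ≤ d·⌊(L−1)/2⌋·L·max_p|A(∂p)|`.
* §3 one level of (2.13): **`abs_bondAvg_sub_centre_le`** — `|(QA)(c) − L⁻¹·A([emb c₋, emb c₋ + Le_μ])| ≤ d·⌊(L−1)/2⌋·max_p|A(∂p)|` for an
  axial `A`; and the curl of an average is an average of fluxes: **`abs_curl_bondAvg_le`** — `max_{p′}|(QA)(∂p′)| ≤ L·max_p|A(∂p)|` (any `A`),
  iterated `abs_curl_bondAvgIter_le` (`≤ L^k·max`).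
* §4 THE MULTILEVEL STATEMENT along the centre lines `embIter`: **`abs_bondAvgIter_sub_cline_le`** — for `A` in the iterated axial gauge
  `δ_{k,Ax}(A)` (4.1.2) and every coarse bond `b` of `T^{(k)}`,
  `|(Q_kA)(b) − L^{−k}·Σ_{b′ ⊂ centre line of b} A(b′)| ≤ d·⌊(L−1)/2⌋·(Σ_{j<k} L^j)·max_p|A(∂p)| ≤ (d/2)·(L^k − 1)·max_p|A(∂p)|`
  (`tgConst`, `tgConst_le`) — the composite-contour structure (5.1.2)–(5.1.3): the line of `b` splits into the lines of the `L` level-`(k−1)`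
  bonds on it (`cline_succ`), each level contributes its own ribbon flux.
HONEST SCOPE.  Pure lattice calculus: no minimizer, no propagator, no constant of the paper is involved; the gauge is r18's CENTRE-anchored
axial gauge (the trees of p09's `V411`), not the corner-anchored one of print's (2.4) (DIVERGENCE F3); the bound is through the global sup of
the plaquette variable (locality is not tracked).  This is the engine of file 2 (`BIJ85AxialLineSum`: `A = H_{k,Ax}B`, whose plaquette
variable is the residual field `f_k`, `O(η·K_R·max|∂B|)` by the all-tori `K_R`), where the factor `L^k − 1` against `η = L^{−k}` gives a
`k`-UNIFORM bound.
-/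

open scoped BigOperators
open Finset

namespace Literature.MathematicalPhysics.QuantumFieldTheory.BalabanImbrieJaffe1984to88.BIJ85TreeGaugeLineSums

open Literature.MathematicalPhysics.QuantumFieldTheory.Balaban1983to89
open LatticeFieldCalculus
open B5Eq120IterProof (stairSum_grad stairSum_sub)
open BIJ85AxialPropagator411 (deltaAx deltaAx_succ stairSum_add)
open BIJ85GaugeFnBound513 (norm_stairSum_le)
open B15DeterminingSets (embIter)

noncomputable section

variable {P : Params} {j : ℕ}

/-! ## §0  Torus bookkeeping: runs, shifts, the centre line of the next block -/

/-- kernel: `x + (t+1)e_μ = (x + te_μ) + e_μ`. [cite: Balaban1984PropagatorsI, (1.7) p.18] -/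
theorem runSite_succ' (x : Site P j) (μ : Fin P.d) (t : ℕ) : runSite x μ (t + 1) = (runSite x μ t).shift μ :=
  runSite_succ x μ t

/-- kernel: a run in direction `μ` commutes with a unit step in any direction `ν` (torus translations commute).
[cite: Balaban1984PropagatorsI, (1.7) p.18] -/
theorem runSite_shift_comm (x : Site P j) (μ ν : Fin P.d) (t : ℕ) : runSite (x.shift ν) μ t = (runSite x μ t).shift ν := by
  funext κ
  by_cases hκμ : κ = μ
  · subst hκμ
    by_cases hκν : κ = ν
    · subst hκν
      simp only [runSite, Site.shift, Function.update_self]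
      ring
    · simp only [runSite, Site.shift, Function.update_self, Function.update_of_ne hκν]
  · by_cases hκν : κ = ν
    · subst hκν
      simp only [runSite, Site.shift, Function.update_self, Function.update_of_ne hκμ]
    · simp only [runSite, Site.shift, Function.update_of_ne hκμ, Function.update_of_ne hκν]

/-- kernel: runs in two directions commute. [cite: Balaban1984PropagatorsI, (1.7) p.18] -/
theorem runSite_comm (x : Site P j) (μ ν : Fin P.d) (t : ℕ) : ∀ s : ℕ, runSite (runSite x ν s) μ t = runSite (runSite x μ t) ν s
  | 0 => by rw [runSite_zero, runSite_zero]
  | s + 1 => by rw [runSite_succ', runSite_succ', runSite_shift_comm, runSite_comm x μ ν t s]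

/-- kernel: the coordinates of a run — `(x + te_μ)_μ = x_μ + t`, `(x + te_μ)_κ = x_κ` (`κ ≠ μ`). [cite: Balaban1984PropagatorsI, (1.7) p.18] -/
theorem runSite_apply_self (x : Site P j) (μ : Fin P.d) (t : ℕ) : runSite x μ t μ = x μ + t := by
  simp [runSite]

/-- kernel: `(x + te_μ)_κ = x_κ` for `κ ≠ μ`. [cite: Balaban1984PropagatorsI, (1.7) p.18] -/
theorem runSite_apply_ne (x : Site P j) {μ κ : Fin P.d} (h : κ ≠ μ) (t : ℕ) : runSite x μ t κ = x κ := by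
  simp [runSite, Function.update_of_ne h]

/-- kernel: **the centre line of a coarse bond ends at the centre of the next block**, `emb y + Le_μ = emb(y + e_μ)` (standing range;
r02's `AveragingRT.lineSite_L`). [cite: Balaban1984PropagatorsI, (1.7) p.18] -/
theorem runSite_emb_L (hj : j + 1 ≤ P.m + P.K) (y : Site P (j + 1)) (μ : Fin P.d) :
    runSite (emb y) μ P.L = emb (y.shift μ) :=
  AveragingRT.lineSite_L hj ⟨y, μ⟩

/-- kernel: the centre embedding scales runs by `L`: `emb(y + te_μ) = emb y + tLe_μ` (standing range). [cite: Balaban1987RG1, (0.1) p.252] -/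
theorem emb_runSite (hj : j + 1 ≤ P.m + P.K) (y : Site P (j + 1)) (μ : Fin P.d) :
    ∀ t : ℕ, emb (runSite y μ t) = runSite (emb y) μ (t * P.L)
  | 0 => by rw [runSite_zero, zero_mul, runSite_zero]
  | t + 1 => by
    rw [runSite_succ', ← runSite_emb_L hj, emb_runSite hj y μ t, B5Eq118OneStroke.runSite_add, Nat.succ_mul]

/-- kernel: the iterated centre embedding scales runs by `L^k`: `embIter k (y + te_μ) = embIter k y + tL^ke_μ` (standing range `k ≤ m + K`).
[cite: Balaban1987RG1, (0.1) p.252] -/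
theorem embIter_runSite : ∀ (k : ℕ), k ≤ P.m + P.K → ∀ (y : Site P k) (μ : Fin P.d) (t : ℕ),
    embIter k (runSite y μ t) = runSite (embIter k y) μ (t * P.L ^ k)
  | 0, _, y, μ, t => by simp [embIter]
  | k + 1, hk, y, μ, t => by
    show embIter k (emb (runSite y μ t)) = runSite (embIter k (emb y)) μ (t * P.L ^ (k + 1))
    rw [emb_runSite hk, embIter_runSite k (by omega), pow_succ, mul_assoc, mul_comm (P.L ^ k)]

/-- kernel: the block centre is the block site with all offsets `(L−1)/2`. [cite: Balaban1987RG1, (0.1) p.252] -/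
theorem emb_eq_blockSite (y : Site P (j + 1)) :
    emb y = Site.blockSite y (fun _ => ⟨(P.L - 1) / 2, AveragingRT.half_lt P⟩) := by
  funext μ
  simp [emb, Site.blockSite]

/-! ## §1  One ribbon: Stokes for a straight run moved one step sideways -/

/-- The ORIENTED CIRCULATION of a bond field around the plaquette at `x` spanned by `e_α` (first) and `e_β`:
`A(⟨x,α⟩) + A(⟨x+e_α,β⟩) − A(⟨x+e_β,α⟩) − A(⟨x,β⟩)` — for `α < β` this is `A(∂p)` = r18's `curl 1 A p`, for `β < α` its negative, for
`α = β` zero ((1.2) of [6I]: *"reversed bonds enter with a minus sign"*). [cite: Balaban1984PropagatorsI, (1.2) p.18] -/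
def pcirc (A : VecField P j ℝ) (x : Site P j) (α β : Fin P.d) : ℝ :=
  A ⟨x, α⟩ + A ⟨x.shift α, β⟩ - A ⟨x.shift β, α⟩ - A ⟨x, β⟩

/-- `pcirc` for `α < β` is the plaquette variable `A(∂p)` (`curl` with lattice factor `1`). [cite: Balaban1984PropagatorsI, (1.2) p.18] -/
theorem pcirc_eq_curl (A : VecField P j ℝ) (x : Site P j) {α β : Fin P.d} (h : α < β) :
    pcirc A x α β = curl 1 A ⟨x, α, β, h⟩ := by
  simp [pcirc, curl]

/-- `pcirc` for `β < α` is minus the plaquette variable of the same plaquette. [cite: Balaban1984PropagatorsI, (1.2) p.18] -/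
theorem pcirc_eq_neg_curl (A : VecField P j ℝ) (x : Site P j) {α β : Fin P.d} (h : β < α) :
    pcirc A x α β = -curl 1 A ⟨x, β, α, h⟩ := by
  simp only [pcirc, curl, one_smul]
  ring

/-- `pcirc` vanishes for `α = β` (degenerate plaquette). [cite: Balaban1984PropagatorsI, (1.2) p.18] -/
theorem pcirc_self (A : VecField P j ℝ) (x : Site P j) (α : Fin P.d) : pcirc A x α α = 0 := by
  simp only [pcirc]
  ring

/-- **`|pcirc| ≤ max_p |A(∂p)|`** in all three cases (`F ≥ 0` a bound of the plaquette variable). [cite: Balaban1984PropagatorsI, (1.2) p.18] -/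
theorem abs_pcirc_le (A : VecField P j ℝ) {F : ℝ} (hF0 : 0 ≤ F) (hF : ∀ p, |curl 1 A p| ≤ F) (x : Site P j) (α β : Fin P.d) :
    |pcirc A x α β| ≤ F := by
  rcases lt_trichotomy α β with h | h | h
  · rw [pcirc_eq_curl A x h]; exact hF _
  · subst h; rw [pcirc_self, abs_zero]; exact hF0
  · rw [pcirc_eq_neg_curl A x h, abs_neg]; exact hF _

/-- The FLUX THROUGH THE RIBBON swept by the bond `⟨x, ν⟩` moved `n` steps in the direction `μ`: `Σ_{t<n} pcirc A (x + te_μ) ν μ` (the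
plaquettes `⟨x + te_μ; ν, μ⟩`; zero for `ν = μ`), as a bond field. [cite: BalabanImbrieJaffe1985, (5.1.2) p.313] -/
def sweepFlux (A : VecField P j ℝ) (μ : Fin P.d) (n : ℕ) : VecField P j ℝ :=
  fun b => ∑ t ∈ range n, pcirc A (runSite b.src μ t) b.dir μ

/-- The bond field READ `n` STEPS FURTHER in the direction `μ`: `(translate A μ n)(⟨x, ν⟩) = A(⟨x + ne_μ, ν⟩)`. [cite: Balaban1984PropagatorsI, (1.7) p.18] -/
def translate (A : VecField P j ℝ) (μ : Fin P.d) (n : ℕ) : VecField P j ℝ :=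
  fun b => A ⟨runSite b.src μ n, b.dir⟩

/-- The straight-run sum `A([x, x + ne_μ])` as a FUNCTION OF ITS BASE POINT `x` (a site function). [cite: Balaban1984PropagatorsI, (1.8) p.19] -/
def lineFn (A : VecField P j ℝ) (μ : Fin P.d) (n : ℕ) : SiteField P j ℝ :=
  fun x => segSum A x μ n

/-- `|sweepFlux| ≤ n·F` bond by bond. [cite: Balaban1984PropagatorsI, (1.2) p.18] -/
theorem abs_sweepFlux_le (A : VecField P j ℝ) {F : ℝ} (hF0 : 0 ≤ F) (hF : ∀ p, |curl 1 A p| ≤ F) (μ : Fin P.d) (n : ℕ)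
    (b : PBond P j) : |sweepFlux A μ n b| ≤ n * F := by
  unfold sweepFlux
  calc |∑ t ∈ range n, pcirc A (runSite b.src μ t) b.dir μ| ≤ ∑ t ∈ range n, |pcirc A (runSite b.src μ t) b.dir μ| :=
        abs_sum_le_sum_abs _ _
    _ ≤ ∑ _t ∈ range n, F := sum_le_sum fun t _ => abs_pcirc_le A hF0 hF _ _ _
    _ = n * F := by rw [sum_const, card_range, nsmul_eq_mul]

/-- **STOKES FOR ONE RIBBON**: moving the base point of a straight run one step sideways changes the run sum by the swept flux plus the
difference of the two end rungs — `A([x+e_ν, x+e_ν+ne_μ]) − A([x, x+ne_μ]) = Σ_{t<n} pcirc A (x+te_μ) ν μ + [A(⟨x+ne_μ, ν⟩) − A(⟨x, ν⟩)]`,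
i.e. `∂^{(1)}(lineFn A μ n) = sweepFlux A μ n + (translate A μ n − A)` as bond fields (also for `ν = μ`, where the flux vanishes and the
identity is the shift of the summation window). [cite: BalabanImbrieJaffe1985, (5.1.2) p.313] -/
theorem grad_lineFn (A : VecField P j ℝ) (μ : Fin P.d) :
    ∀ n : ℕ, grad 1 (lineFn A μ n) = fun b => sweepFlux A μ n b + (translate A μ n b - A b)
  | 0 => by
    funext b
    simp [grad, lineFn, segSum, sweepFlux, translate, runSite_zero]
  | n + 1 => by
    funext b
    have ih := congr_fun (grad_lineFn A μ n) b
    simp only [grad, lineFn, one_smul, PBond.tgt] at ih ⊢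
    rw [segSum, segSum, sum_range_succ, sum_range_succ, ← segSum, ← segSum]
    simp only [sweepFlux, translate, sum_range_succ] at ih ⊢
    have key : A (runBond (b.src.shift b.dir) μ n) - A (runBond b.src μ n)
        = pcirc A (runSite b.src μ n) b.dir μ + (A ⟨runSite b.src μ (n + 1), b.dir⟩ - A ⟨runSite b.src μ n, b.dir⟩) := by
      simp only [runBond, runSite_shift_comm, pcirc, runSite_succ']
      ring
    linear_combination ih + key

/-! ## §2  Staircases: two base points, translation covariance, the axial gauge of a block -/

/-- kernel: a run from an updated base point, read `n` steps further in the direction `μ` (both coordinate cases).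
[cite: Balaban1984PropagatorsI, (1.7) p.18] -/
theorem runSite_update_sub (w : Site P j) (μ ν : Fin P.d) (n : ℕ) (s : ZMod (P.sitesPerDir j)) :
    runSite (Function.update w ν (w ν - s)) μ n = Function.update (runSite w μ n) ν (runSite w μ n ν - s) := by
  funext κ
  by_cases hκν : κ = ν
  · subst hκν
    by_cases hκμ : κ = μ
    · subst hκμ
      simp only [runSite, Function.update_self]
      ring
    · simp only [runSite, Function.update_self, Function.update_of_ne hκμ, Function.update_of_ne (Ne.symm hκμ)]
  · by_cases hκμ : κ = μ
    · subst hκμ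
      simp only [runSite, Function.update_self, Function.update_of_ne hκν, Function.update_of_ne (Ne.symm hκν)]
    · simp only [runSite, Function.update_of_ne hκν, Function.update_of_ne hκμ]

/-- kernel: **translation covariance of the signed run sums** — reading the field `n` steps further = running from the translated
base point. [cite: Balaban1984PropagatorsI, (1.7) p.18] -/
theorem runSum_translate (A : VecField P j ℝ) (μ : Fin P.d) (n : ℕ) (w : Site P j) (ν : Fin P.d) :
    ∀ m : ℤ, runSum (translate A μ n) w ν m = runSum A (runSite w μ n) ν m
  | (m : ℕ) => by
    simp only [runSum, translate]
    refine sum_congr rfl fun t _ => ?_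
    rw [runSite_comm]
  | Int.negSucc m => by
    simp only [runSum, translate]
    congr 1
    refine sum_congr rfl fun t _ => ?_
    rw [runSite_update_sub]

/-- kernel: the corners of the staircase move with the translation. [cite: Balaban1984PropagatorsI, (1.7) p.18] -/
theorem mixSite_runSite (ν μ : Fin P.d) (y x : Site P j) (n : ℕ) :
    mixSite ν (runSite y μ n) (runSite x μ n) = runSite (mixSite ν y x) μ n := by
  funext κ
  by_cases hκ : κ = μ
  · subst hκ
    simp only [mixSite, runSite, Function.update_self]
    split_ifs <;> rfl
  · simp only [mixSite, runSite, Function.update_of_ne hκ]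

/-- kernel: the coordinate displacements of the staircase are translation invariant. [cite: Balaban1984PropagatorsI, (1.7) p.18] -/
theorem runSite_sub_runSite_apply (y x : Site P j) (μ : Fin P.d) (n : ℕ) (κ : Fin P.d) :
    runSite x μ n κ - runSite y μ n κ = x κ - y κ := by
  by_cases hκ : κ = μ
  · subst hκ; simp only [runSite, Function.update_self]; ring
  · simp only [runSite, Function.update_of_ne hκ]

/-- **TRANSLATION COVARIANCE OF THE STAIRCASE SUMS**: `(translate A μ n)(Γ_{y,x}) = A(Γ_{y+ne_μ, x+ne_μ})` — the staircase from `y`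
to `x`, read `n` steps further, is the staircase between the translated endpoints. [cite: Balaban1984PropagatorsI, (1.7) p.18] -/
theorem stairSum_translate (A : VecField P j ℝ) (μ : Fin P.d) (n : ℕ) (y x : Site P j) :
    stairSum (translate A μ n) y x = stairSum A (runSite y μ n) (runSite x μ n) := by
  unfold stairSum
  refine sum_congr rfl fun ν _ => ?_
  rw [runSum_translate, mixSite_runSite, runSite_sub_runSite_apply]

/-- **TWO BASE POINTS** (Stokes for the loop: staircase `Γ_{y,x}`, run from `x`, translated staircase backwards, run from `y` backwards):
`A([x, x+ne_μ]) − A([y, y+ne_μ]) = sweepFlux(Γ_{y,x}) + [A(Γ_{y+ne_μ, x+ne_μ}) − A(Γ_{y,x})]` — the telescoping of `∂(lineFn)` along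
the staircase (`B5Eq120IterProof.stairSum_grad`) with §1. [cite: BalabanImbrieJaffe1985, (5.1.2) p.313] -/
theorem segSum_sub_segSum_eq (A : VecField P j ℝ) (μ : Fin P.d) (n : ℕ) (y x : Site P j) :
    segSum A x μ n - segSum A y μ n =
      stairSum (sweepFlux A μ n) y x + (stairSum A (runSite y μ n) (runSite x μ n) - stairSum A y x) := by
  have h := stairSum_grad 1 (lineFn A μ n) y x
  rw [grad_lineFn, one_smul] at h
  rw [show (fun b => sweepFlux A μ n b + (translate A μ n b - A b)) = sweepFlux A μ n + (fun b => translate A μ n b - A b)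
      from rfl, stairSum_add, stairSum_sub, stairSum_translate] at h
  simp only [lineFn] at h
  linarith

/-- **IN THE AXIAL GAUGE OF A BLOCK the straight-run sums from two sites of the block differ by a flux only**: for `A` axial
(`A(Γ_{emb y, x}) = 0`, `x ∈ B(y)`; r18's `IsAxial`, centred blocks) and every offset `r`,
`|A([x_r, x_r + Le_μ]) − A([emb y, emb y + Le_μ])| ≤ d·⌊(L−1)/2⌋·L·F` whenever `|A(∂p)| ≤ F` for all plaquettes (standing range; the two
staircase terms vanish by the gauge condition in `B(y)` and in `B(y + e_μ)`, the flux term has at most `d·⌊(L−1)/2⌋` rungs of weight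
`≤ L·F`). [cite: BalabanImbrieJaffe1985, (4.1.2) p.309] -/
theorem abs_segSum_sub_segSum_centre_le (hj : j + 1 ≤ P.m + P.K) {A : VecField P j ℝ} (hAx : IsAxial A) {F : ℝ} (hF0 : 0 ≤ F)
    (hF : ∀ p, |curl 1 A p| ≤ F) (y : Site P (j + 1)) (r : Fin P.d → Fin P.L) (μ : Fin P.d) :
    |segSum A (Site.blockSite y r) μ P.L - segSum A (emb y) μ P.L| ≤ ((P.d * ((P.L - 1) / 2) : ℕ) : ℝ) * (P.L * F) := by
  have hax : ∀ (y' : Site P (j + 1)), stairSum A (emb y') (Site.blockSite y' r) = 0 := by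
    intro y'
    by_cases h : Site.blockSite y' r = emb y'
    · rw [h, stairSum_self]
    · exact hAx y' r h
  rw [segSum_sub_segSum_eq, runSite_emb_L hj, runSite_blockSite_L hj, hax, hax, sub_zero, add_zero]
  have hb : ∀ b, ‖sweepFlux A μ P.L b‖ ≤ P.L * F := fun b => by
    rw [Real.norm_eq_abs]; exact abs_sweepFlux_le A hF0 hF μ P.L b
  have h := norm_stairSum_le hj (sweepFlux A μ P.L) hb y r
  rwa [Real.norm_eq_abs] at h

/-! ## §3  One level of (2.13): the block average against the centre run; the curl of an average -/

/-- kernel: `|B(y)| = L^d` offsets. [cite: Balaban1987RG1, (0.3) p.252] -/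
theorem card_offsets (P : Params) : Fintype.card (Fin P.d → Fin P.L) = P.L ^ P.d := by
  rw [Fintype.card_fun, Fintype.card_fin, Fintype.card_fin]

/-- **(2.13) SPLIT AT THE CENTRE**: `(QA)(c) = L⁻¹·A([emb c₋, emb c₋ + Le_μ]) + L^{−(d+1)}Σ_{x∈B(c₋)}[A([x, x + Le_μ]) − A([emb c₋, emb c₋ + Le_μ])]`.
[cite: BalabanImbrieJaffe1985, (2.13) p.304] -/
theorem bondAvg_eq_centre_add (A : VecField P j ℝ) (c : PBond P (j + 1)) :
    bondAvg A c = (P.L : ℝ)⁻¹ * segSum A (emb c.src) c.dir P.L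
      + ((P.L : ℝ) ^ (P.d + 1))⁻¹ *
          ∑ r : Fin P.d → Fin P.L, (segSum A (Site.blockSite c.src r) c.dir P.L - segSum A (emb c.src) c.dir P.L) := by
  have hL : (P.L : ℝ) ≠ 0 := Nat.cast_ne_zero.mpr P.L_pos.ne'
  unfold bondAvg
  rw [smul_eq_mul, sum_sub_distrib, sum_const, card_univ, card_offsets, nsmul_eq_mul]
  push_cast
  field_simp
  ring

/-- **ONE LEVEL, AXIAL GAUGE**: `|(QA)(c) − L⁻¹·A([emb c₋, emb c₋ + Le_μ])| ≤ d·⌊(L−1)/2⌋·F` for `A` axial with `|A(∂p)| ≤ F` (standing range).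
[cite: BalabanImbrieJaffe1985, (2.13) p.304] -/
theorem abs_bondAvg_sub_centre_le (hj : j + 1 ≤ P.m + P.K) {A : VecField P j ℝ} (hAx : IsAxial A) {F : ℝ} (hF0 : 0 ≤ F)
    (hF : ∀ p, |curl 1 A p| ≤ F) (c : PBond P (j + 1)) :
    |bondAvg A c - (P.L : ℝ)⁻¹ * segSum A (emb c.src) c.dir P.L| ≤ ((P.d * ((P.L - 1) / 2) : ℕ) : ℝ) * F := by
  have hL : (0 : ℝ) < P.L := Nat.cast_pos.mpr P.L_pos
  set C : ℝ := ((P.d * ((P.L - 1) / 2) : ℕ) : ℝ) with hC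
  have hC0 : 0 ≤ C := by rw [hC]; exact Nat.cast_nonneg _
  rw [bondAvg_eq_centre_add, add_sub_cancel_left, abs_mul, abs_inv, abs_of_pos (pow_pos hL _)]
  calc ((P.L : ℝ) ^ (P.d + 1))⁻¹ *
        |∑ r : Fin P.d → Fin P.L, (segSum A (Site.blockSite c.src r) c.dir P.L - segSum A (emb c.src) c.dir P.L)|
      ≤ ((P.L : ℝ) ^ (P.d + 1))⁻¹ * ∑ r : Fin P.d → Fin P.L, C * (P.L * F) := by
        refine mul_le_mul_of_nonneg_left ((abs_sum_le_sum_abs _ _).trans (sum_le_sum fun r _ => ?_)) (by positivity)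
        exact abs_segSum_sub_segSum_centre_le hj hAx hF0 hF c.src r c.dir
    _ = C * F := by
        rw [sum_const, card_univ, card_offsets, nsmul_eq_mul, pow_succ]
        push_cast
        field_simp

/-- kernel: `translate` moves the base point of a run sum. [cite: Balaban1984PropagatorsI, (1.8) p.19] -/
theorem segSum_translate (A : VecField P j ℝ) (α : Fin P.d) (n : ℕ) (x : Site P j) (β : Fin P.d) (m : ℕ) :
    segSum (translate A α n) x β m = segSum A (runSite x α n) β m := by
  simp only [segSum, translate, runBond]
  refine sum_congr rfl fun t _ => ?_
  rw [runSite_comm]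

/-- **STOKES FOR A SQUARE**: the circulation around the `n × n` square at `x` spanned by `e_α`, `e_β` is minus the swept flux of its `β`-side:
`A([x,x+ne_α]) + A([x+ne_α, x+ne_α+ne_β]) − A([x+ne_β, x+ne_β+ne_α]) − A([x, x+ne_β]) = −Σ_{s<n}Σ_{t<n} pcirc A (x+se_β+te_α) β α`.
[cite: Balaban1984PropagatorsI, (1.2) p.18] -/
theorem square_circ (A : VecField P j ℝ) (x : Site P j) (α β : Fin P.d) (n : ℕ) :
    segSum A x α n + segSum A (runSite x α n) β n - segSum A (runSite x β n) α n - segSum A x β n =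
      -segSum (sweepFlux A α n) x β n := by
  have h := segSum_grad 1 (lineFn A α n) x β n
  rw [grad_lineFn, one_smul] at h
  rw [show (fun b => sweepFlux A α n b + (translate A α n b - A b)) = sweepFlux A α n + (fun b => translate A α n b - A b)
      from rfl, BIJ85AxialPropagator411.segSum_add, B5Eq120IterProof.segSum_sub, segSum_translate] at h
  simp only [lineFn] at h
  linarith

/-- **THE CURL OF A BLOCK AVERAGE IS AN AVERAGE OF FLUXES**: `(QA)(∂p′) = −L^{−(d+1)}Σ_{x∈B(p′₋)} Σ_{s,t<L} pcirc A (x+se_β+te_α) β α` for the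
coarse plaquette `p′ = ⟨y; α < β⟩` (each offset `x` contributes the circulation of `A` around the `L × L` square at `x`; standing range).
[cite: BalabanImbrieJaffe1985, (2.13) p.304] -/
theorem curl_bondAvg_eq (hj : j + 1 ≤ P.m + P.K) (A : VecField P j ℝ) (p' : Plaq P (j + 1)) :
    curl 1 (bondAvg A) p' =
      ((P.L : ℝ) ^ (P.d + 1))⁻¹ * ∑ r : Fin P.d → Fin P.L, -segSum (sweepFlux A p'.μ P.L) (Site.blockSite p'.src r) p'.ν P.L := by
  simp only [curl, bondAvg, smul_eq_mul, one_mul]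
  rw [← mul_add, ← mul_sub, ← mul_sub, ← sum_add_distrib, ← sum_sub_distrib, ← sum_sub_distrib]
  congr 1
  refine sum_congr rfl fun r _ => ?_
  rw [← square_circ, ← runSite_blockSite_L hj, ← runSite_blockSite_L hj]

/-- **`max_{p′}|(QA)(∂p′)| ≤ L·max_p|A(∂p)|`** — averaging does not increase the plaquette variable beyond the factor `L` of the coarse
circulation (standing range). [cite: BalabanImbrieJaffe1985, (2.13) p.304] -/
theorem abs_curl_bondAvg_le (hj : j + 1 ≤ P.m + P.K) (A : VecField P j ℝ) {F : ℝ} (hF0 : 0 ≤ F) (hF : ∀ p, |curl 1 A p| ≤ F)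
    (p' : Plaq P (j + 1)) : |curl 1 (bondAvg A) p'| ≤ P.L * F := by
  have hL : (0 : ℝ) < P.L := Nat.cast_pos.mpr P.L_pos
  have hb : ∀ b, ‖sweepFlux A p'.μ P.L b‖ ≤ P.L * F := fun b => by
    rw [Real.norm_eq_abs]; exact abs_sweepFlux_le A hF0 hF _ P.L b
  rw [curl_bondAvg_eq hj, abs_mul, abs_inv, abs_of_pos (pow_pos hL _)]
  calc ((P.L : ℝ) ^ (P.d + 1))⁻¹ * |∑ r : Fin P.d → Fin P.L, -segSum (sweepFlux A p'.μ P.L) (Site.blockSite p'.src r) p'.ν P.L|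
      ≤ ((P.L : ℝ) ^ (P.d + 1))⁻¹ * ∑ r : Fin P.d → Fin P.L, P.L * (P.L * F) := by
        refine mul_le_mul_of_nonneg_left ((abs_sum_le_sum_abs _ _).trans (sum_le_sum fun r _ => ?_)) (by positivity)
        rw [abs_neg, ← Real.norm_eq_abs]
        exact BIJ85GaugeFnBound513.norm_segSum_le _ hb _ _ _
    _ = P.L * F := by
        rw [sum_const, card_univ, card_offsets, nsmul_eq_mul, pow_succ]
        push_cast
        field_simp

/-- **`max|(Q_kA)(∂p′)| ≤ L^k·max|A(∂p)|`** (iteration of `abs_curl_bondAvg_le`; standing range `k ≤ m + K`). [cite: BalabanImbrieJaffe1985, (2.23) p.305] -/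
theorem abs_curl_bondAvgIter_le : ∀ (k : ℕ), k ≤ P.m + P.K → ∀ (A : VecField P 0 ℝ) {F : ℝ}, 0 ≤ F → (∀ p, |curl 1 A p| ≤ F) →
    ∀ p', |curl 1 (bondAvgIter k A) p'| ≤ (P.L : ℝ) ^ k * F
  | 0, _, A, F, _, hF, p' => by rw [B5Eq120IterProof.bondAvgIter_zero, pow_zero, one_mul]; exact hF p'
  | k + 1, hk, A, F, hF0, hF, p' => by
    rw [B5Eq120IterProof.bondAvgIter_succ, pow_succ, mul_comm ((P.L : ℝ) ^ k), mul_assoc]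
    exact abs_curl_bondAvg_le hk _ (by positivity) (abs_curl_bondAvgIter_le k (by omega) A hF0 hF) p'

/-! ## §4  The multilevel statement along the centre lines `embIter` -/

/-- The CENTRE LINE SUM of a fine bond field along a coarse bond `b = ⟨y, y + e_μ⟩` of `T^{(k)}`: `Σ_{t<L^k} A(⟨embIter_k y + te_μ, μ⟩)`, the
straight run of `L^k` fine bonds from the iterated block centre (the line of (4.5.3)/(5.1.2) in the centred convention of `Setup`).
[cite: BalabanImbrieJaffe1985, (5.1.2) p.313] -/
def cline (k : ℕ) (A : VecField P 0 ℝ) (b : PBond P k) : ℝ :=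
  segSum A (embIter k b.src) b.dir (P.L ^ k)

/-- At level `0` the centre line of a bond is the bond. [cite: BalabanImbrieJaffe1985, (5.1.2) p.313] -/
theorem cline_zero (A : VecField P 0 ℝ) (b : PBond P 0) : cline 0 A b = A b := by
  simp [cline, embIter, segSum, runBond, runSite_zero]

/-- **THE COMPOSITE STRUCTURE (5.1.2)–(5.1.3) OF THE CENTRE LINES**: the centre line of a bond of `T^{(k+1)}` is the concatenation of the
centre lines of the `L` bonds of `T^{(k)}` on it (standing range). [cite: BalabanImbrieJaffe1985, (5.1.3) p.314] -/
theorem cline_succ {k : ℕ} (hk : k + 1 ≤ P.m + P.K) (A : VecField P 0 ℝ) (b : PBond P (k + 1)) :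
    cline (k + 1) A b = ∑ t ∈ range P.L, cline k A (runBond (emb b.src) b.dir t) := by
  unfold cline
  rw [show embIter (k + 1) b.src = embIter k (emb b.src) from rfl, pow_succ', B5Eq118OneStroke.segSum_mul]
  refine sum_congr rfl fun t _ => ?_
  rw [← embIter_runSite k (by omega)]
  rfl

/-- The constant of the multilevel estimate: `d·⌊(L−1)/2⌋·Σ_{j<k}L^j` (`= (d/2)(L^k − 1)`, `tgConst_eq`). [cite: BalabanImbrieJaffe1985, (5.1.3) p.314] -/
def tgConst (P : Params) (k : ℕ) : ℝ :=
  ((P.d * ((P.L - 1) / 2) : ℕ) : ℝ) * ∑ i ∈ range k, (P.L : ℝ) ^ i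

/-- `tgConst` is nonnegative. [cite: BalabanImbrieJaffe1985, (5.1.3) p.314] -/
theorem tgConst_nonneg (P : Params) (k : ℕ) : 0 ≤ tgConst P k :=
  mul_nonneg (Nat.cast_nonneg _) (sum_nonneg fun _ _ => pow_nonneg (Nat.cast_nonneg _) _)

/-- `tgConst P (k+1) = tgConst P k + d·⌊(L−1)/2⌋·L^k`. [cite: BalabanImbrieJaffe1985, (5.1.3) p.314] -/
theorem tgConst_succ (P : Params) (k : ℕ) :
    tgConst P (k + 1) = tgConst P k + ((P.d * ((P.L - 1) / 2) : ℕ) : ℝ) * (P.L : ℝ) ^ k := by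
  simp only [tgConst, sum_range_succ, mul_add]

/-- **`tgConst P k = (d/2)·(L^k − 1)`** (`L` odd: `⌊(L−1)/2⌋ = (L−1)/2`; geometric sum). [cite: BalabanImbrieJaffe1985, (5.1.3) p.314] -/
theorem tgConst_eq (P : Params) (k : ℕ) : tgConst P k = (P.d : ℝ) / 2 * ((P.L : ℝ) ^ k - 1) := by
  have hL1 : (P.L : ℝ) ≠ 1 := by have := P.hL.2; exact_mod_cast this.ne'
  have hh : (((P.L - 1) / 2 : ℕ) : ℝ) = ((P.L : ℝ) - 1) / 2 := by
    have h := AveragingRT.two_mul_half_add_one P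
    have h' : (2 : ℝ) * (((P.L - 1) / 2 : ℕ) : ℝ) + 1 = P.L := by exact_mod_cast h
    linarith
  unfold tgConst
  rw [geom_sum_eq hL1, Nat.cast_mul, hh]
  have hL1' : (P.L : ℝ) - 1 ≠ 0 := sub_ne_zero.mpr hL1
  field_simp

/-- `tgConst P k ≤ (d/2)·L^k`. [cite: BalabanImbrieJaffe1985, (5.1.3) p.314] -/
theorem tgConst_le (P : Params) (k : ℕ) : tgConst P k ≤ (P.d : ℝ) / 2 * (P.L : ℝ) ^ k := by
  rw [tgConst_eq]
  have : (0 : ℝ) ≤ P.d / 2 := by positivity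
  nlinarith

/-- **LINE SUMS OF A FIELD IN THE ITERATED AXIAL GAUGE ARE ITS BLOCK AVERAGES, UP TO A FLUX**: for every fine bond field `A` in the gauge
`δ_{k,Ax}(A)` of (4.1.2) (p09's `deltaAx k A`: `Q_jA` axial on `T^{(j)}` for all `j < k`, centred trees) with `|A(∂p)| ≤ F` on every fine
plaquette, and every bond `b` of `T^{(k)}` (standing range `k ≤ m + K`):
`|(Q_kA)(b) − L^{−k}·cline_k(A)(b)| ≤ tgConst(k)·F = (d/2)(L^k − 1)·F`.  Level `j` contributes `d·⌊(L−1)/2⌋·L^j·F`: its ribbon has `≤ d⌊(L−1)/2⌋·L`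
plaquettes of `T^{(j)}`, each carrying at most `L^j·F` (`abs_curl_bondAvgIter_le`), against the weight `L⁻¹`; the lines telescope by
`cline_succ`. [cite: BalabanImbrieJaffe1985, (7.3.2) p.326] -/
theorem abs_bondAvgIter_sub_cline_le : ∀ (k : ℕ), k ≤ P.m + P.K → ∀ (A : VecField P 0 ℝ), deltaAx k A → ∀ {F : ℝ}, 0 ≤ F →
    (∀ p, |curl 1 A p| ≤ F) → ∀ b : PBond P k, |bondAvgIter k A b - ((P.L : ℝ) ^ k)⁻¹ * cline k A b| ≤ tgConst P k * F
  | 0, _, A, _, F, _, _, b => by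
    simp [B5Eq120IterProof.bondAvgIter_zero, cline_zero, tgConst]
  | k + 1, hk, A, hAx, F, hF0, hF, b => by
    have hL : (0 : ℝ) < P.L := Nat.cast_pos.mpr P.L_pos
    have hLne : (P.L : ℝ) ≠ 0 := hL.ne'
    obtain ⟨hAxk, hax⟩ := (deltaAx_succ k A).1 hAx
    set A' : VecField P k ℝ := bondAvgIter k A with hA'
    set C : ℝ := ((P.d * ((P.L - 1) / 2) : ℕ) : ℝ) with hC
    -- the plaquette variable of `A' = Q_kA`
    have hF' : ∀ p', |curl 1 A' p'| ≤ (P.L : ℝ) ^ k * F := abs_curl_bondAvgIter_le k (by omega) A hF0 hF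
    have hF'0 : 0 ≤ (P.L : ℝ) ^ k * F := by positivity
    -- step 1: one level in the axial gauge of the blocks of `T^{(k+1)}`
    have e1 : |bondAvg A' b - (P.L : ℝ)⁻¹ * segSum A' (emb b.src) b.dir P.L| ≤ C * ((P.L : ℝ) ^ k * F) :=
      abs_bondAvg_sub_centre_le hk hax hF'0 hF' b
    -- step 2: the `L` bonds on the centre run, each by the induction hypothesis
    have ih : ∀ t, |A' (runBond (emb b.src) b.dir t) - ((P.L : ℝ) ^ k)⁻¹ * cline k A (runBond (emb b.src) b.dir t)| ≤ tgConst P k * F :=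
      fun t => abs_bondAvgIter_sub_cline_le k (by omega) A hAxk hF0 hF _
    have eq2 : (P.L : ℝ)⁻¹ * segSum A' (emb b.src) b.dir P.L - ((P.L : ℝ) ^ (k + 1))⁻¹ * cline (k + 1) A b
        = (P.L : ℝ)⁻¹ * ∑ t ∈ range P.L,
            (A' (runBond (emb b.src) b.dir t) - ((P.L : ℝ) ^ k)⁻¹ * cline k A (runBond (emb b.src) b.dir t)) := by
      rw [cline_succ hk, segSum, sum_sub_distrib, mul_sub, mul_sum, mul_sum, mul_sum]
      congr 1
      refine sum_congr rfl fun t _ => ?_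
      rw [pow_succ, mul_inv]
      ring
    have e2 : |(P.L : ℝ)⁻¹ * segSum A' (emb b.src) b.dir P.L - ((P.L : ℝ) ^ (k + 1))⁻¹ * cline (k + 1) A b| ≤ tgConst P k * F := by
      rw [eq2, abs_mul, abs_inv, abs_of_pos hL]
      calc (P.L : ℝ)⁻¹ * |∑ t ∈ range P.L, (A' (runBond (emb b.src) b.dir t) - ((P.L : ℝ) ^ k)⁻¹ * cline k A (runBond (emb b.src) b.dir t))|
          ≤ (P.L : ℝ)⁻¹ * ∑ t ∈ range P.L, tgConst P k * F :=
            mul_le_mul_of_nonneg_left ((abs_sum_le_sum_abs _ _).trans (sum_le_sum fun t _ => ih t)) (by positivity)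
        _ = tgConst P k * F := by rw [sum_const, card_range, nsmul_eq_mul]; field_simp
    have split : bondAvg A' b - ((P.L : ℝ) ^ (k + 1))⁻¹ * cline (k + 1) A b
        = (bondAvg A' b - (P.L : ℝ)⁻¹ * segSum A' (emb b.src) b.dir P.L)
          + ((P.L : ℝ)⁻¹ * segSum A' (emb b.src) b.dir P.L - ((P.L : ℝ) ^ (k + 1))⁻¹ * cline (k + 1) A b) := by ring
    rw [B5Eq120IterProof.bondAvgIter_succ, ← hA', split, tgConst_succ]
    calc _ ≤ C * ((P.L : ℝ) ^ k * F) + tgConst P k * F := (abs_add_le _ _).trans (add_le_add e1 e2)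
      _ = _ := by rw [hC]; ring

/-- The same with the simplified constant: `|(Q_kA)(b) − L^{−k}·cline_k(A)(b)| ≤ (d/2)·L^k·F`. [cite: BalabanImbrieJaffe1985, (7.3.2) p.326] -/
theorem abs_bondAvgIter_sub_cline_le' {k : ℕ} (hk : k ≤ P.m + P.K) {A : VecField P 0 ℝ} (hAx : deltaAx k A) {F : ℝ} (hF0 : 0 ≤ F)
    (hF : ∀ p, |curl 1 A p| ≤ F) (b : PBond P k) :
    |bondAvgIter k A b - ((P.L : ℝ) ^ k)⁻¹ * cline k A b| ≤ (P.d : ℝ) / 2 * (P.L : ℝ) ^ k * F :=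
  (abs_bondAvgIter_sub_cline_le k hk A hAx hF0 hF b).trans (mul_le_mul_of_nonneg_right (tgConst_le P k) hF0)

end

end Literature.MathematicalPhysics.QuantumFieldTheory.BalabanImbrieJaffe1984to88.BIJ85TreeGaugeLineSums
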